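import Summits.AnomalousDissipation.AnomalousDissipation.Theorems.SolenoidalFractalHomogenisationRealisedQuasiStaticCellLawLowSectorDecayRates
import Summits.AnomalousDissipation.AnomalousDissipation.Theorems.SolenoidalFractalHomogenisationRealisedQuasiStaticCellLawWeakFarSlotAlgebra
import Summits.AnomalousDissipation.AnomalousDissipation.Theorems.SolenoidalFractalHomogenisationRealisedQuasiStaticCellLawWeakFarScalars
import Summits.AnomalousDissipation.AnomalousDissipation.Theorems.SolenoidalFractalHomogenisationRealisedQuasiStaticCellLawStrongScalars
import Summits.AnomalousDissipation.AnomalousDissipation.Theorems.SolenoidalFractalHomogenisationRealisedQuasiStaticCellLawCellSlotFormulas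
import Summits.AnomalousDissipation.AnomalousDissipation.Theorems.SolenoidalFractalHomogenisationRealisedQuasiStaticCellLawSectorRelabel
import Summits.AnomalousDissipation.AnomalousDissipation.Theorems.SolenoidalFractalHomogenisationRealisedQuasiStaticCellLawWeakArithmetic
import HarnessLib

/-!
# K2R `RealisedQuasiStaticCellLaw`, line `floquet-bloch`, stub `stub_lowSectorStrong`: the S road (strongly coupled low
# sectors) at the replayed cell word (helper; `--supports stmt-AnomalousDissipation-20446`)

Summits-side helper file (everything proved; no definitions, no named facts). g2's `lowSector_decay_of_rates` instantiated at
`W′ = (cubatureWord.stretch M).stretch (1/ν)`, `κ = ν/n²`, in the good slot of `exists_goodSlot_sign` (representative `σℓ`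
with positive coupling): for `M ≥ max(10, 10¹⁸/δ²)`, `ν ≤ 1`, `8π²·3720·M(1 + c_W) + 30000 ≤ nν` and a sector label `ℓ`
with `(δ/10⁴)nν ≤ ‖ℓ‖`, `|ℓ|² < 1 + (1 − δ)c_W/ν²`, every weak solution from the sector decays at the rate
`8π²(1 + (1−δ)c_W/ν²)ν/n²` with prefactor `(8π²·3720·M(1 + c_W) + 30000)/ν` (`strong_decay_at_cell`).
-/

set_option linter.dupNamespace false

noncomputable section

namespace Summit.AnomalousDissipation.AnomalousDissipation.Theorems.SolenoidalFractalHomogenisation.RealisedQuasiStaticCellLaw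

open Set MeasureTheory Filter Topology Function Matrix
open scoped InnerProductSpace ComplexConjugate Matrix
open Literature.Analysis Literature.Analysis.FunctionSpaces Literature.Analysis.FunctionSpaces.Torus
open Literature.Analysis.FluidPDE Literature.Analysis.FluidPDE.LatticeShear

/-- `latticeVec (σ • ℓ) = σ • latticeVec ℓ`; for a sign `σ = ±1` the norm is unchanged and inner products change by `σ`. -/
theorem latticeVec_sign_smul (ℓ : Fin 3 → ℤ) {σ : ℤ} (hσ : σ = 1 ∨ σ = -1) :
    latticeVec (σ • ℓ) = (σ : ℝ) • latticeVec ℓ ∧ ‖latticeVec (σ • ℓ)‖ = ‖latticeVec ℓ‖ ∧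
      ∀ v : EuclideanSpace ℝ (Fin 3), |⟪v, latticeVec (σ • ℓ)⟫_ℝ| = |⟪v, latticeVec ℓ⟫_ℝ| := by
  have h1 : latticeVec (σ • ℓ) = (σ : ℝ) • latticeVec ℓ := by
    ext i
    simp [latticeVec_apply]
  have hσ1 : |(σ : ℝ)| = 1 := by rcases hσ with rfl | rfl <;> simp
  refine ⟨h1, by rw [h1, norm_smul, Real.norm_eq_abs, hσ1, one_mul], fun v => ?_⟩
  rw [h1, inner_smul_right, abs_mul, hσ1, one_mul]

/-- **The S road at the cell word.** -/
theorem strong_decay_at_cell {δ M ν : ℝ} (hδ : 0 < δ) (hδ1 : δ ≤ 1) (hM : 0 < M) (hM10 : 10 ≤ M)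
    (hMδ : 10 ^ 18 / δ ^ 2 ≤ M) (hν : 0 < ν) (hν1 : ν ≤ 1) {n : ℕ}
    (hKn : 8 * Real.pi ^ 2 * 3720 * M * (1 + (1 - 4 * cubatureWord.ramp / 3) * c0) + 30000 ≤ (n : ℝ) * ν)
    (ℓ : Fin 3 → ℤ) (hℓ : ℓ ≠ 0) (hbig : δ / 10000 * ((n : ℝ) * ν) ≤ ‖latticeVec ℓ‖)
    (hQ : freqNormSq ℓ < 1 + (1 - δ) * ((1 - 4 * cubatureWord.ramp / 3) * c0) / ν ^ 2)
    {w₀ : UnitAddTorus (Fin 3) → EuclideanSpace ℝ (Fin 3)}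
    (hw₀ : FunctionSpaces.Torus.MemSobolev 1 (FunctionSpaces.EuclideanSpace.complexify ∘ w₀))
    (hdiv : FunctionSpaces.Torus.IsWeaklyDivFree w₀) (hmean : FunctionSpaces.Torus.HasZeroMean w₀)
    (hsupp : ∀ k : Fin 3 → ℤ, ¬ ((∃ z : Fin 3 → ℤ, k = ℓ + (n:ℤ) • z) ∨ (∃ z : Fin 3 → ℤ, k = -ℓ + (n:ℤ) • z)) →
      UnitAddTorus.mFourierCoeff (FunctionSpaces.EuclideanSpace.complexify ∘ w₀) k = 0)
    {T : ℝ} (hT : 0 < T) {w : ℝ → UnitAddTorus (Fin 3) → EuclideanSpace ℝ (Fin 3)}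
    (hw : Torus.IsWeakPassiveVectorOn 0 T (ν / (n : ℝ) ^ 2)
      (((cubatureWord.stretch M hM).stretch (1 / ν) (one_div_pos.mpr hν)).cell n) w₀ w) :
    ∀ᵐ t ∂(volume.restrict (Ioo 0 T)), ∫ x, ‖w t x‖ ^ 2 ≤
      ((8 * Real.pi ^ 2 * 3720 * M * (1 + (1 - 4 * cubatureWord.ramp / 3) * c0) + 30000) / ν) *
        Real.exp (-(8 * Real.pi ^ 2 * (1 + (1 - δ) * ((1 - 4 * cubatureWord.ramp / 3) * c0) / ν ^ 2) * ν /
          (n : ℝ) ^ 2) * t) * ∫ x, ‖w₀ x‖ ^ 2 := by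
  classical
  obtain ⟨W', hW'⟩ : ∃ W' : LatticeWord 26, W' = (cubatureWord.stretch M hM).stretch (1 / ν) (one_div_pos.mpr hν) :=
    ⟨_, rfl⟩
  rw [← hW'] at hw
  have hπ := Real.pi_gt_three
  have hc0p := c0_pos
  have hρ : cubatureWord.ramp = 1 / 2 := (cubature_phase_fields 0).2.2.2
  have hcc : c0 = 7 / (4960 * Real.pi ^ 4) := rfl
  have hcW : 0 < (1 - 4 * cubatureWord.ramp / 3) * c0 := by rw [hρ]; positivity
  have hcW1 : (1 - 4 * cubatureWord.ramp / 3) * c0 ≤ 1 := by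
    rw [hρ, hcc]
    have h9 : (9 : ℝ) ≤ Real.pi ^ 2 := by nlinarith
    have hπ4 : (81 : ℝ) ≤ Real.pi ^ 4 := by
      rw [show Real.pi ^ 4 = (Real.pi ^ 2) ^ 2 by ring]; nlinarith [h9]
    rw [show (1 - 4 * (1 / 2 : ℝ) / 3) * (7 / (4960 * Real.pi ^ 4)) = 7 / 3 / (4960 * Real.pi ^ 4) by ring,
      div_le_one (by positivity)]
    nlinarith
  have hnν : 30000 ≤ (n : ℝ) * ν := by
    have : 0 ≤ 8 * Real.pi ^ 2 * 3720 * M * (1 + (1 - 4 * cubatureWord.ramp / 3) * c0) := by positivity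
    linarith
  have hn : 0 < n := Nat.pos_of_ne_zero (by rintro rfl; norm_num at hnν)
  have hn' : (0 : ℝ) < n := by exact_mod_cast hn
  have hκ : 0 < ν / (n : ℝ) ^ 2 := by positivity
  -- the good slot and the sign
  obtain ⟨j, σ, hσ, hθge, hθpos, hmℓ⟩ := exists_goodSlot_sign ℓ hℓ
  obtain ⟨hvec, hnorm', hinn'⟩ := latticeVec_sign_smul ℓ hσ
  -- the slot constants of `W'`
  have hcs := fun j => cellSlot_formulas cubatureWord hM hν hn j (σ • ℓ)
  have hfm : ∀ j, (W'.phase j).m = (cubatureWord.phase j).m := fun j => by rw [hW']; exact (hcs j).1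
  have hfe : ∀ j, (W'.phase j).e = (cubatureWord.phase j).e := fun j => by rw [hW']; exact (hcs j).2.1
  have hfφ : ∀ j, (W'.phase j).φ = (cubatureWord.phase j).φ := fun j => by rw [hW']; exact (hcs j).2.2.1
  have hfτ : ∀ j, (W'.phase j).τ = M * (cubatureWord.phase j).τ / ν := fun j => by
    rw [hW']; exact (hcs j).2.2.2.1
  have hframp : W'.ramp = cubatureWord.ramp := by rw [hW']; exact (hcs 0).2.2.2.2.1
  have hfP : W'.period = M * 3720 / ν := by rw [hW', (hcs 0).2.2.2.2.2.1, period_cubatureWord]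
  have hΛ := fun j => (hcs j).2.2.2.2.2.2.1
  have hg := fun j => (hcs j).2.2.2.2.2.2.2.2.1
  clear hcs
  have hslot := cubature_slot_bounds j
  -- sector data
  have ha1 : 1 ≤ ‖latticeVec ℓ‖ := one_le_norm_latticeVec hℓ
  have ha0 : 0 < ‖latticeVec ℓ‖ := by linarith
  have hA : freqNormSq ℓ = ‖latticeVec ℓ‖ ^ 2 := (norm_latticeVec_sq ℓ).symm
  have han' : 10000 * ‖latticeVec ℓ‖ ≤ (n : ℝ) := by
    -- `‖ℓ‖²ν² < ν² + (1 − δ)c_W ≤ 2`, so `‖ℓ‖ν < 2`, and `nν ≥ 30000`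
    have h1 : ‖latticeVec ℓ‖ ^ 2 * ν ^ 2 < ν ^ 2 + (1 - δ) * ((1 - 4 * cubatureWord.ramp / 3) * c0) := by
      rw [← hA]
      have := (lt_div_iff₀ (by positivity : (0:ℝ) < ν ^ 2)).1
        (show (freqNormSq ℓ - 1) < (1 - δ) * ((1 - 4 * cubatureWord.ramp / 3) * c0) / ν ^ 2 by linarith only [hQ])
      linarith only [this]
    have hX1 : (1 - δ) * ((1 - 4 * cubatureWord.ramp / 3) * c0) ≤ 1 :=
      (mul_le_of_le_one_left hcW.le (by linarith only [hδ])).trans hcW1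
    have hν2 : ν ^ 2 ≤ 1 := pow_le_one₀ hν.le hν1
    have h2 : (‖latticeVec ℓ‖ * ν) ^ 2 < 2 ^ 2 := by
      have e : (‖latticeVec ℓ‖ * ν) ^ 2 = ‖latticeVec ℓ‖ ^ 2 * ν ^ 2 := by ring
      rw [e]; linarith only [h1, hX1, hν2]
    have h3 : ‖latticeVec ℓ‖ * ν < 2 := by
      nlinarith only [h2, mul_nonneg ha0.le hν.le]
    nlinarith only [h3, hnν, hν]
  have hℓ'0 : σ • ℓ ≠ 0 := by
    intro h
    have : ‖latticeVec (σ • ℓ)‖ = 0 := by rw [h]; simp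
    rw [hnorm'] at this
    linarith
  have hℓn : 2 * ‖latticeVec (σ • ℓ)‖ ≤ n := by rw [hnorm']; linarith
  have hsupp' : ∀ k' : Fin 3 → ℤ, ¬ ((∃ z : Fin 3 → ℤ, k' = σ • ℓ + (n:ℤ) • z) ∨
      (∃ z : Fin 3 → ℤ, k' = -(σ • ℓ) + (n:ℤ) • z)) →
      UnitAddTorus.mFourierCoeff (FunctionSpaces.EuclideanSpace.complexify ∘ w₀) k' = 0 :=
    fun k' hk' => hsupp k' fun h => hk' ((sector_iff_sign ℓ n hσ k').mp h)
  -- the `m_j`-coupling: `|m_j·ℓ| ≥ √(7/130)‖ℓ‖‖m_j‖`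
  have hmabs : Real.sqrt (7 / 130) * (‖latticeVec ℓ‖ * ‖latticeVec (cubatureWord.phase j).m‖) ≤
      |⟪latticeVec (cubatureWord.phase j).m, latticeVec (σ • ℓ)⟫_ℝ| := by
    rw [hinn']
    have h := Real.sqrt_le_sqrt hmℓ
    rw [show 7 / 130 * (‖latticeVec ℓ‖ ^ 2 * ‖latticeVec (cubatureWord.phase j).m‖ ^ 2) =
        7 / 130 * (‖latticeVec ℓ‖ * ‖latticeVec (cubatureWord.phase j).m‖) ^ 2 by ring,
      Real.sqrt_mul (by norm_num), Real.sqrt_sq (by positivity), Real.sqrt_sq_eq_abs] at h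
    exact h
  have hinner : ⟪latticeVec (cubatureWord.phase j).m, latticeVec (σ • ℓ)⟫_ℝ =
      (latticeVec (σ • ℓ)) 0 * ((cubatureWord.phase j).m 0 : ℝ) + (latticeVec (σ • ℓ)) 1 * ((cubatureWord.phase j).m 1 : ℝ) +
        (latticeVec (σ • ℓ)) 2 * ((cubatureWord.phase j).m 2 : ℝ) :=
    cubatureWord_inner_m j (latticeVec (σ • ℓ))
  have hxK : (fun i => (((σ • ℓ) i : ℤ) : ℝ)) ⬝ᵥ (fun i => (((fun i => (cubatureWord.phase j).m i * (n : ℤ)) i : ℤ) : ℝ)) =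
      (n : ℝ) * ⟪latticeVec (cubatureWord.phase j).m, latticeVec (σ • ℓ)⟫_ℝ := by
    rw [(dot_cast_cellFreq (σ • ℓ) (cubatureWord.phase j).m n).1, hinner]
  -- the target exponent and the prefactor
  obtain ⟨c, hc⟩ : ∃ c : ℝ, c = 8 * Real.pi ^ 2 * 3720 * M *
      (1 + (1 - δ) * ((1 - 4 * cubatureWord.ramp / 3) * c0) / ν ^ 2) / (n : ℝ) ^ 2 := ⟨_, rfl⟩
  have hc0' : 0 ≤ c := by
    rw [hc]
    have : 0 ≤ (1 - δ) * ((1 - 4 * cubatureWord.ramp / 3) * c0) / ν ^ 2 :=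
      div_nonneg (mul_nonneg (by linarith) hcW.le) (by positivity)
    positivity
  have hpref := far_prefactor hM hν hν1 hn' hδ.le hcW (by linarith) hc
  have main : ∀ᵐ t ∂(volume.restrict (Ioo 0 T)), ∫ x, ‖w t x‖ ^ 2 ≤
      Real.exp c * Real.exp (-(c / W'.period) * t) * ∫ x, ‖w₀ x‖ ^ 2 := by
    refine lowSector_decay_of_rates W' hn hκ (σ • ℓ) hℓ'0 hℓn hw₀ hdiv hmean hsupp' j ?_ ?_ ?_ hc0' ?_ ?_ hT hw
    · rw [hfe j]; exact hθpos
    · rw [hfm j, (dot_cast_facts (σ • ℓ) (σ • ℓ)).1, hxK, hnorm', abs_mul, abs_of_pos hn']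
      have h1 := mul_le_mul_of_nonneg_left hmabs hn'.le
      have h23 := sqrt_seven_div_ge
      have hbm := hslot.2.2.2.1
      have h2 : 23 / 100 * ‖latticeVec ℓ‖ ≤
          Real.sqrt (7 / 130) * (‖latticeVec ℓ‖ * ‖latticeVec (cubatureWord.phase j).m‖) :=
        mul_le_mul h23 (le_mul_of_one_le_right ha0.le hbm) ha0.le (Real.sqrt_nonneg _)
      have h3 := mul_le_mul_of_nonneg_left h2 hn'.le
      have h4 := mul_le_mul_of_nonneg_left han' ha0.le
      nlinarith only [h1, h3, h4, ha0]
    · rw [hfm j, (dot_cast_cellFreq ℓ _ n).2, hnorm']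
      have hbm := hslot.2.2.2.1
      have : (n : ℝ) ≤ n * ‖latticeVec (cubatureWord.phase j).m‖ := le_mul_of_one_le_right hn'.le hbm
      linarith only [this, han', ha0]
    · rw [hfτ j, hframp]
      exact strong_hcF hpref.1 hM10 hslot.2.2.2.2 hν hn' hρ
    · rw [hfm j, hfe j, hfφ j, hfτ j, hframp, hg j, hΛ j]
      refine strong_hcP hpref.1 hδ hδ1 hMδ hν hn' ha0 hbig han' hslot.1 hslot.2.1 hslot.2.2.2.1 hslot.2.2.1
        hslot.2.2.2.2 hθge (by rw [(dot_cast_facts (σ • ℓ) (σ • ℓ)).1, hnorm'])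
        (by rw [(dot_cast_facts (fun i => (cubatureWord.phase j).m i * (n : ℤ)) ℓ).1, (dot_cast_cellFreq ℓ _ n).2])
        ?_ hρ
      rw [hxK, abs_mul, abs_of_pos hn']
      have h1 := mul_le_mul_of_nonneg_left hmabs hn'.le
      linarith only [h1]
  -- prefactor and rate
  have hrate : c / W'.period = 8 * Real.pi ^ 2 * (1 + (1 - δ) * ((1 - 4 * cubatureWord.ramp / 3) * c0) / ν ^ 2) * ν /
      (n : ℝ) ^ 2 := by
    rw [hfP, hc]
    field_simp
  have hX : 0 ≤ ∫ x, ‖w₀ x‖ ^ 2 := integral_nonneg fun x => by positivity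
  have hC : Real.exp c ≤ (8 * Real.pi ^ 2 * 3720 * M * (1 + (1 - 4 * cubatureWord.ramp / 3) * c0) + 30000) / ν := by
    have h1 : Real.exp c ≤ 74 * Real.exp c := by linarith only [Real.exp_pos c]
    have h2 : (8 * Real.pi ^ 2 * 3720 * M * (1 + (1 - 4 * cubatureWord.ramp / 3) * c0) + 300) / ν ≤
        (8 * Real.pi ^ 2 * 3720 * M * (1 + (1 - 4 * cubatureWord.ramp / 3) * c0) + 30000) / ν :=
      div_le_div_of_nonneg_right (by linarith only []) hν.le
    linarith only [h1, h2, hpref.2]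
  have hK0 : 0 ≤ (8 * Real.pi ^ 2 * 3720 * M * (1 + (1 - 4 * cubatureWord.ramp / 3) * c0) + 30000) / ν :=
    le_trans (Real.exp_pos c).le hC
  filter_upwards [main, ae_restrict_mem measurableSet_Ioo] with t ht htI
  refine ht.trans ?_
  rw [hrate]
  exact decay_form_mono hC hK0 le_rfl htI.1.le hX

end Summit.AnomalousDissipation.AnomalousDissipation.Theorems.SolenoidalFractalHomogenisation.RealisedQuasiStaticCellLaw

end
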